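import Mathlib
import Summits.Ventures.HodgeRepro2.T5CyclotomicUnramified

/-!
# THE RESIDUE DEGREE OF AN UNRAMIFIED PRIME IN A SUBFIELD OF `ℚ(ζₘ)` IS THE ORDER OF `p` IN `(ℤ/mℤ)ˣ / H_F`

Tier-5 support N2 / N3 / §G-N4.2 (seat p3, gen 81). File 47 (`T5CyclotomicUnramified`) gives, for an intermediate field
`F ⊆ ℚ(ζₘ)` and a prime `p ∤ m`, that `p` is unramified in `F`, that `f(𝔭/p) ∣ ord_m(p)` and that `f(𝔭/p) = 1` when
`ord_m(p)` is prime to `[F : ℚ]`; the exact value stayed in prose. This file proves the classical formula: with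
`H_F ≤ (ℤ/mℤ)ˣ` the image of `Gal(ℚ(ζₘ)/F)` under Mathlib's `galEquivZMod` (the subgroup cutting out `F`),

  `f(𝔭/p) = ord((p mod m) · H_F)` in `(ℤ/mℤ)ˣ / H_F`, equivalently `f(𝔭/p) · #(H_F ∩ ⟨p⟩) = ord_m(p)`,

for every prime `𝔭` of `F` above `p`. The proof is the tower `f(P/p) = f(𝔭/p) · f(P/𝔭)` for a prime `P` of `ℚ(ζₘ)`
above `𝔭`, Mathlib's `inertiaDeg_eq_of_not_dvd` (`f(P/p) = ord_m(p)`) and `galEquivZMod_stabilizer` (the decomposition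
group of `P` is `⟨p⟩`), and the count `#D(P/𝔭) = f(P/𝔭)` of the decomposition group of the Galois extension
`ℚ(ζₘ)/F` (Mathlib's `card_stabilizer_eq`), which is `D(P/p) ∩ Gal(ℚ(ζₘ)/F)`. Consumers: the census of a sextic CM
subfield of a cyclotomic field (file 281's `exists_map_eq_iff_even_inertiaDeg_sextic` needs `f(P/p)` even), the
non-cyclotomic instances of the brief's «sextic Galois CM case».

* `orderOf_mk_mul_card_inf`: in a finite group, `ord(aH) · #(H ∩ ⟨a⟩) = ord(a)`;
* `zmodSubgroup L F`: the subgroup `H_F` of `(ℤ/mℤ)ˣ`;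
* `card_stabilizer_subgroup`, `card_stabilizer_gal_eq_card_inf`: `#D(P/𝔭)` in `Gal(ℚ(ζₘ)/F)` is
  `#(Gal(ℚ(ζₘ)/F) ∩ D(P/p))`;
* **`inertiaDeg_mul_card_inf_eq_orderOf`**: `f(𝔭/p) · #(H_F ∩ ⟨p⟩) = ord_m(p)`;
* **`inertiaDeg_eq_orderOf_mk`**: `f(𝔭/p) = ord(p · H_F)` in `(ℤ/mℤ)ˣ / H_F`;
* `ncard_primesOver_mul_orderOf_mk`: `#{𝔭 ∣ p} · ord(p · H_F) = [F : ℚ]`.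

§8(d): uses an L-value-free non-vanishing device: NO.
-/

open NumberField IsCyclotomicExtension.Rat Ideal MulAction
open scoped Pointwise

namespace Summit.Ventures.HodgeRepro2.T5CyclotomicSubfieldInertiaDeg

section Group

variable {G : Type*} [Group G]

/-- **The order of `aH` in `G/H` times `#(H ∩ ⟨a⟩)` is the order of `a`** (the image of `⟨a⟩ → G/H` is `⟨aH⟩`,
its kernel `H ∩ ⟨a⟩`). -/
theorem orderOf_mk_mul_card_inf (H : Subgroup G) [H.Normal] (a : G) :
    orderOf (QuotientGroup.mk a : G ⧸ H) * Nat.card (H ⊓ Subgroup.zpowers a : Subgroup G) =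
      orderOf a := by
  classical
  set φ : Subgroup.zpowers a →* G ⧸ H :=
    (QuotientGroup.mk' H).comp (Subgroup.zpowers a).subtype with hφ
  have h1 : Nat.card φ.ker * φ.ker.index = Nat.card (Subgroup.zpowers a) :=
    Subgroup.card_mul_index φ.ker
  rw [Subgroup.index_ker, Nat.card_zpowers] at h1
  have hrange : φ.range = Subgroup.zpowers (QuotientGroup.mk a : G ⧸ H) := by
    rw [hφ, MonoidHom.range_comp, Subgroup.range_subtype, MonoidHom.map_zpowers]
    rfl
  have hker : φ.ker = H.subgroupOf (Subgroup.zpowers a) := by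
    ext x
    simp [hφ, MonoidHom.mem_ker, Subgroup.mem_subgroupOf, QuotientGroup.eq_one_iff]
  have hcard : Nat.card φ.ker = Nat.card (H ⊓ Subgroup.zpowers a : Subgroup G) := by
    rw [hker, ← Subgroup.inf_subgroupOf_right]
    exact Nat.card_congr (Subgroup.subgroupOfEquivOfLe inf_le_right).toEquiv
  rw [hrange, Nat.card_zpowers, hcard, mul_comm] at h1
  exact h1

/-- `#Stab_H(x) = #(H ⊓ Stab_G(x))`: the stabiliser of `x` in a subgroup `H` (a subtype of `H`) is in bijection
with `H ⊓ Stab_G(x)`. -/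
theorem card_stabilizer_subgroup {X : Type*} [MulAction G X] (H : Subgroup G) (x : X) :
    Nat.card (stabilizer H x) = Nat.card (H ⊓ stabilizer G x : Subgroup G) :=
  Nat.card_congr
    { toFun := fun σ => ⟨σ.1.1, σ.1.2, σ.2⟩
      invFun := fun σ => ⟨⟨σ.1, σ.2.1⟩, σ.2.2⟩
      left_inv := fun _ => rfl
      right_inv := fun _ => rfl }

end Group

section Subfield

variable (m : ℕ) [NeZero m] (L : Type*) [Field L] [NumberField L] [IsCyclotomicExtension {m} ℚ L]
  (F : IntermediateField ℚ L)

/-- **The subgroup `H_F ≤ (ℤ/mℤ)ˣ` cutting out the subfield `F ⊆ ℚ(ζₘ)`**: the image of `Gal(ℚ(ζₘ)/F)` under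
Mathlib's `galEquivZMod : Gal(ℚ(ζₘ)/ℚ) ≃* (ℤ/mℤ)ˣ`. -/
noncomputable def zmodSubgroup : Subgroup (ZMod m)ˣ :=
  (galEquivZMod m L).mapSubgroup F.fixingSubgroup

variable {m L F} in
/-- Membership in `H_F`: `a ∈ H_F` iff the automorphism `ζ ↦ ζ^a` fixes `F` pointwise. -/
theorem mem_zmodSubgroup_iff (a : (ZMod m)ˣ) :
    a ∈ zmodSubgroup m L F ↔ (galEquivZMod m L).symm a ∈ F.fixingSubgroup := by
  unfold zmodSubgroup
  constructor
  · rintro ⟨σ, hσ, rfl⟩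
    change (galEquivZMod m L).symm ((galEquivZMod m L) σ) ∈ F.fixingSubgroup
    rw [(galEquivZMod m L).symm_apply_apply σ]
    exact hσ
  · intro h
    exact ⟨(galEquivZMod m L).symm a, h, (galEquivZMod m L).apply_symm_apply a⟩

/-- `#H_F = [ℚ(ζₘ) : F]`. -/
theorem card_zmodSubgroup : Nat.card (zmodSubgroup m L F) = Module.finrank F L := by
  have : IsGalois ℚ L := IsCyclotomicExtension.isGalois {m} ℚ L
  unfold zmodSubgroup
  rw [← IsGalois.card_fixingSubgroup_eq_finrank]
  exact (Nat.card_congr (Subgroup.equivMapOfInjective _ _ (galEquivZMod m L).injective).toEquiv).symm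

variable (p : ℕ) [hp : Fact p.Prime]

/-- The decomposition group of a prime `P` of `ℚ(ζₘ)` in `Gal(ℚ(ζₘ)/F)` has the cardinality of
`Gal(ℚ(ζₘ)/F) ∩ D(P/p)` inside `Gal(ℚ(ζₘ)/ℚ)`. -/
theorem card_stabilizer_gal_eq_card_inf (P : Ideal (𝓞 L)) :
    Nat.card (stabilizer (L ≃ₐ[F] L) P) =
      Nat.card (F.fixingSubgroup ⊓ stabilizer (L ≃ₐ[ℚ] L) P : Subgroup (L ≃ₐ[ℚ] L)) := by
  rw [← card_stabilizer_subgroup]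
  refine (Nat.card_congr (Ideal.stabilizerEquiv P (IntermediateField.fixingSubgroupEquiv F) ?_).toEquiv).symm
  intro σ x
  rfl

variable (hpm : p.Coprime m) (𝔭 : Ideal (𝓞 F)) [h𝔭 : 𝔭.IsPrime] [h𝔭p : 𝔭.LiesOver (span {(p : ℤ)})]

include hpm h𝔭 h𝔭p in
/-- **THE RESIDUE DEGREE OF `p ∤ m` IN A SUBFIELD `F ⊆ ℚ(ζₘ)`**: `f(𝔭/p) · #(H_F ∩ ⟨p⟩) = ord_m(p)` for every prime
`𝔭` of `F` above `p` (`⟨p⟩ = ⟨p mod m⟩ ≤ (ℤ/mℤ)ˣ`). -/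
theorem inertiaDeg_mul_card_inf_eq_orderOf :
    𝔭.inertiaDeg ℤ *
      Nat.card (zmodSubgroup m L F ⊓ Subgroup.zpowers (ZMod.unitOfCoprime p hpm) : Subgroup (ZMod m)ˣ) =
        orderOf (ZMod.unitOfCoprime p hpm) := by
  classical
  have hL : IsGalois ℚ L := IsCyclotomicExtension.isGalois {m} ℚ L
  have hLF : IsGalois F L := IsGalois.tower_top_of_isGalois ℚ F L
  have hGal : IsGaloisGroup (L ≃ₐ[F] L) (𝓞 F) (𝓞 L) := IsGaloisGroup.of_isFractionRing _ _ _ F L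
  have hm : ¬ p ∣ m := (Nat.Prime.coprime_iff_not_dvd hp.out).mp hpm
  -- a prime `P` of `ℚ(ζₘ)` above `𝔭`
  obtain ⟨⟨P, hP, hP𝔭⟩⟩ := (inferInstance : Nonempty (primesOver 𝔭 (𝓞 L)))
  haveI : P.LiesOver (span {(p : ℤ)}) := LiesOver.trans P 𝔭 (span {(p : ℤ)})
  haveI : P.IsMaximal := IsMaximal.of_liesOver_isMaximal P (span {(p : ℤ)})
  haveI : 𝔭.IsMaximal := IsMaximal.of_liesOver_isMaximal 𝔭 (span {(p : ℤ)})
  -- the tower of residue degrees and ramification indices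
  have htower : P.inertiaDeg ℤ = 𝔭.inertiaDeg ℤ * P.inertiaDeg (𝓞 F) :=
    inertiaDeg_tower (R := ℤ) 𝔭 P
  have hetower : P.ramificationIdx ℤ = 𝔭.ramificationIdx ℤ * P.ramificationIdx (𝓞 F) :=
    ramificationIdx_tower (R := ℤ) 𝔭 P
  have heP : P.ramificationIdx ℤ = 1 := ramificationIdx_eq_of_not_dvd p L P hm
  have hfP : P.inertiaDeg ℤ = orderOf (p : ZMod m) := inertiaDeg_eq_of_not_dvd p L P hm
  have heP𝔭 : P.ramificationIdx (𝓞 F) = 1 := by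
    rw [heP] at hetower
    exact Nat.eq_one_of_mul_eq_one_left hetower.symm
  -- the decomposition group of `P` over `𝔭` has `f(P/𝔭)` elements
  have hcard : Nat.card (stabilizer (L ≃ₐ[F] L) P) = P.inertiaDeg (𝓞 F) := by
    rw [card_stabilizer_eq 𝔭 P, ramificationIdxIn_eq_ramificationIdx 𝔭 P (L ≃ₐ[F] L),
      inertiaDegIn_eq_inertiaDeg 𝔭 P (L ≃ₐ[F] L), heP𝔭, one_mul]
  -- and is `Gal(ℚ(ζₘ)/F) ∩ D(P/p)`, which `galEquivZMod` carries to `H_F ∩ ⟨p⟩`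
  have hinf : Nat.card (stabilizer (L ≃ₐ[F] L) P) =
      Nat.card (zmodSubgroup m L F ⊓ Subgroup.zpowers (ZMod.unitOfCoprime p hpm) : Subgroup (ZMod m)ˣ) := by
    rw [card_stabilizer_gal_eq_card_inf, ← galEquivZMod_stabilizer m L p P hpm]
    have hmap := Subgroup.map_inf F.fixingSubgroup (stabilizer (L ≃ₐ[ℚ] L) P)
      (galEquivZMod m L).toMonoidHom (galEquivZMod m L).injective
    change Nat.card _ = Nat.card (Subgroup.map (galEquivZMod m L).toMonoidHom F.fixingSubgroup ⊓
      Subgroup.map (galEquivZMod m L).toMonoidHom (stabilizer (L ≃ₐ[ℚ] L) P) : Subgroup (ZMod m)ˣ)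
    rw [← hmap]
    exact Nat.card_congr (Subgroup.equivMapOfInjective _ _ (galEquivZMod m L).injective).toEquiv
  have hord : orderOf (ZMod.unitOfCoprime p hpm) = orderOf (p : ZMod m) := by
    rw [← orderOf_injective _ Units.coeHom_injective, Units.coeHom_apply, ZMod.coe_unitOfCoprime]
  rw [hord, ← hfP, htower, ← hcard, hinf]

include hpm h𝔭 h𝔭p in
/-- **THE RESIDUE DEGREE OF `p ∤ m` IN `F ⊆ ℚ(ζₘ)` IS THE ORDER OF `p · H_F` IN `(ℤ/mℤ)ˣ / H_F`** — the printed
formula «`f = ord(p)` in `(ℤ/mℤ)ˣ / H`». -/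
theorem inertiaDeg_eq_orderOf_mk :
    𝔭.inertiaDeg ℤ =
      orderOf (QuotientGroup.mk (ZMod.unitOfCoprime p hpm) : (ZMod m)ˣ ⧸ zmodSubgroup m L F) := by
  have h1 := inertiaDeg_mul_card_inf_eq_orderOf m L F p hpm 𝔭
  have h2 := orderOf_mk_mul_card_inf (zmodSubgroup m L F) (ZMod.unitOfCoprime p hpm)
  have hpos : 0 < Nat.card (zmodSubgroup m L F ⊓ Subgroup.zpowers (ZMod.unitOfCoprime p hpm) :
      Subgroup (ZMod m)ˣ) := Nat.card_pos
  exact Nat.eq_of_mul_eq_mul_right hpos (h1.trans h2.symm)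

include hpm h𝔭 h𝔭p in
/-- `#{𝔭 ∣ p} · ord(p · H_F) = [F : ℚ]` (the fundamental identity with the residue degree read off
`(ℤ/mℤ)ˣ / H_F`). -/
theorem ncard_primesOver_mul_orderOf_mk :
    ((span {(p : ℤ)}).primesOver (𝓞 F)).ncard *
      orderOf (QuotientGroup.mk (ZMod.unitOfCoprime p hpm) : (ZMod m)ˣ ⧸ zmodSubgroup m L F) =
        Module.finrank ℚ F := by
  rw [← inertiaDeg_eq_orderOf_mk m L F p hpm 𝔭]
  exact T5CyclotomicUnramified.ncard_primesOver_mul_inertiaDeg p L F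
    ((Nat.Prime.coprime_iff_not_dvd hp.out).mp hpm) 𝔭

end Subfield

end Summit.Ventures.HodgeRepro2.T5CyclotomicSubfieldInertiaDeg
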